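import Literature.NumberTheory.LFunctions.NoExceptionalZeroUpToTenPowTen
import Literature.NumberTheory.LFunctions.RealCharacterLadderLeaves
import HarnessLib

/-!
# The explicit Deuring–Heilbronn phenomenon for Dirichlet `L`-functions
# (Benli–Goel–Twiss–Zaman 2025, §§1–2: Corollaries 1.1–1.2, Theorem 1.3, Hypotheses 2.1/2.6,
# Lemma 2.9) — and its vacuity on the certified no-exceptional-zero tables

Topic `Literature/NumberTheory/LFunctions` (namespace `Literature.NumberTheory.LFunctions`, paper
sub-namespace `BGTZ2025`). STATEMENT LAYER for the cell `parity-realchar` (SIEGEL INSTRUMENT,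
deliverable "illusory-world conditionals"): the EXPLICIT repulsion that a hypothetical
Landau–Siegel zero `β₁` of `∏_{χ mod q} L(s,χ)` exerts on every other zero, AS PRINTED, as NAMED
FACTS (D-0014; closed `Prop`s, not proved here), together with PROVED bookkeeping: on the range of
the certified tables the hypothesis "`∏_χ L(s,χ)` has a real zero `β₁ > 1 − 1/(10 log q)`" is void —
for `q ≤ 4·10⁵` by Platt (the source's own remark), for `q ≤ 10⁹` by the cell's two-lineage leaf
`NoRealZeroUpTo_1e9` with McCurley's theorem, for `q ≤ 10¹⁰` by Lu–Zaman–Zhao's Theorem 1.1 with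
McCurley's theorem (`luZamanZhao2026_corollary12_of`). The tree's inexplicit forms are
`Literature.NumberTheory.LFunctions.deuring_heilbronn` (rh.S33, Bombieri's normalisation, DISCHARGED)
and the class-group version `Literature.NumberTheory.LFunctions.NumberField.deuringHeilbronn`
(Thorner–Zaman 2017, PROVED); nothing there is restated — the present file records numerical
constants `c₁, …, c₄` only print supplies.

## What the source prints (held text `paper:arxiv-2410.06082` = arXiv v1/v2, read 2026-08-25; ERRATUM
2026-08-27: the accepted arXiv v3 = PAMS 154 (2026) 509–525 changes the constant `K` of Theorem 1.3 only —
see `theorem13'`; every other display quoted below is identical in v3)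

K. Benli, S. Goel, H. Twiss, A. Zaman, *Explicit Deuring–Heilbronn phenomenon for Dirichlet
`L`-functions*, Proc. Amer. Math. Soc. (2025), doi:10.1090/proc/17450 = arXiv:2410.06082.
§1: "For any integer `q ≥ 1`, define the function `𝓛_q(s) := ∏_{χ (mod q)} L(s,χ)` (1.1) …
**Corollary 1.1.** Let `T ≥ 4` be real and `q > 400,000` be an integer. Assume `𝓛_q(s)` given by
(1.1) has a real zero at `s = β₁ > 1 − 1/(10 log q)`. If `ρ = β + iγ` is another zero of `𝓛_q(s)`
satisfying `β > 1/2` and `|γ| ≤ T`, then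
`β < 1 − log( c₄ / ((1 − β₁)(c₁ log q + c₂ log T + c₃)) ) / (c₁ log q + c₂ log T + c₃)` (1.2),
where `c₁ = 10, c₂ = 1, c₃ = 107, c₄ = 1/16`. Remarks. Platt has verified computationally that a
Landau–Siegel zero does not exist for `q ≤ 400,000`, so the above statement is known to be
vacuous for such `q`. … **Corollary 1.2.** Fix `ε > 0`. Let `T ≥ 4` be real and `q > 400,000` be an
integer. Assume `𝓛_q(s)` … has a real zero at `s = β₁ > 1 − 1/(10 log q)`. If `ρ = β + iγ` is
another zero of `𝓛_q(s)` satisfying `β > 1/2` and `|γ| ≤ T`, then (1.2) holds with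
`c₁ = 4/3 + ε, c₂ = 2/3 + ε, c₃ = 0, c₄ = 1/24`, provided `qT ≥ C(ε)` for some ineffective
sufficiently large positive constant `C(ε)`. … The first completely explicit version of (1.2) was
recently proved by Thorner–Zaman. Their result implies `c₁ = 54.2, c₂ = 16.9, c₃ = 104.7,
c₄ = 0.0002` are admissible for (1.2)." "**Theorem 1.3.** Let `q > 400,000` and `T ≥ 4`. Fix
`A, B ≥ 1`, `0 < θ ≤ 1/4`, and `0 < ε ≤ 1/2`. Assume every primitive Dirichlet character
`ψ (mod q_ψ)` satisfies `|L(1/2 + it, ψ)| ≤ A (q_ψ(1 + |t|))^θ` for `t ∈ ℝ`. Assume `𝓛_q(s)` given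
by (1.1) has a real zero at `s = β₁` satisfying `1 − 1/(10 log q) < β₁ < 1 − B/(q^ε (log q)²)`. If
`ρ = β + iγ` is another zero of `𝓛_q(s)` satisfying `β > 1/2` and `|γ| ≤ T`, then
`β < 1 − log( θ / (4(1 − β₁) log M) ) / log M` (1.4), where `M = K q^{8θ+2ε} T^{4θ}` and
`K = 10^{25} A^{20} B^{−2} e^{8(log q)^{3/4}} (log q)^{28}` (1.5)."
§2: "**Hypothesis 2.1.** Fix constants `A ≥ 1` and `0 < θ ≤ 1/4`. Assume for `t ∈ ℝ` and any
primitive Dirichlet character `ψ (mod q_ψ)` that `|L(1/2 + it, ψ)| ≤ A (q_ψ(1 + |t|))^θ`. …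
**Proposition 2.4 (Thorner–Zaman).** For `t ∈ ℝ` and any primitive character `ψ (mod q_ψ)`,
`|L(1/2 + it, ψ)| ≤ 2.97655 (q_ψ(1 + |t|))^{1/4}`. … **Hypothesis 2.6.** Fix `B > 0` and
`0 < ε ≤ 1/2`. For any integer `q ≥ 3`, if `𝓛_q(s)` given by (1.1) has a real zero at `s = β₁`
satisfying `β₁ > 1 − 1/(10 log q)`, then `β₁ < 1 − B/(q^ε (log q)²)`. … **Theorem 2.8
(Bordignon).** Hypothesis 2.6 holds with `ε = 1/2` and `B = 100`. … **Lemma 2.9.** Let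
`q > 400,000` be an integer. If `1 − 1/(10 log q) < β₁ < 1` is a real zero of `L(s, χ₁)` where
`χ₁ (mod q)` is a real quadratic character, then `0.72 ≤ L(1,χ₁)/(1 − β₁) ≤ 0.18 (log q)²`."

## Lean rendering / design choices

* `L(s,χ) = DirichletCharacter.LFunction χ s` (Mathlib; entire for `χ ≠ χ₀`). "`𝓛_q(s)` has a
  real zero at `s = β₁`" (`β₁` in the stated window) ⟺ `L(β₁, χ₁) = 0` for SOME `χ₁ mod q`; as a
  hypothesis this is the `∀ χ₁` form used below. We add `β₁ < 1` (a real ZERO of `𝓛_q`, which does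
  not vanish on `[1, ∞)`; at `s = 1` the principal `L`-function has a POLE, where Mathlib assigns a
  finite junk value) — nothing printed is lost.
* "another zero `ρ = β + iγ` of `𝓛_q(s)`": `L(ρ, χ) = 0` for some `χ mod q`, `ρ ≠ β₁` (the zero
  `β₁` of `𝓛_q` is simple by McCurley's theorem quoted in the source's §1, so "another zero" is
  another POINT), and `ρ ≠ 1` (the pole again). `β = ρ.re`, `γ = ρ.im`.
* The inequality (1.2) with constants `c₁, …, c₄` is packaged as `BGTZ2025.Repulsion c₁ c₂ c₃ c₄ q T`
  (a `Prop`-valued definition with a body) so that Corollaries 1.1, 1.2 and the Thorner–Zaman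
  constants are instances of ONE shape; `BGTZ2025.repulsionBound` is the right-hand side of (1.2).
* Hypotheses 2.1 and 2.6 are parametrised predicates `HypothesisA A θ`, `HypothesisB B ε`;
  Proposition 2.4 and Theorem 2.8 are named facts instantiating them (Thorner–Zaman 2024 Prop. 2.10
  and Bordignon 2019/2020, as quoted and weakened in the source).
* `q_ψ (1 + |t|)` etc. are real; `(log q)^{3/4}` is `Real.log q ^ (3/4 : ℝ)`.

PROVED here (no monotonicity of (1.2) in the constants is claimed — the bound is not monotone in a
simple way): the VACUITY of the common hypothesis on certified ranges —
`no_landauSiegelZero_of_zeroFreeRegionUpTo` (under `ZeroFreeRegionUpTo Q 10 10`, no character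
mod `10 ≤ q ≤ Q` has a real zero in `(1 − 1/(10 log q), 1)`), its instances
`no_landauSiegelZero_upTo_1e9` (cell leaf `NoRealZeroUpTo_1e9` + `McCurley1984_theorem1`) and
`no_landauSiegelZero_upTo_1e10` (`luZamanZhao2026_theorem11` + `McCurley1984_theorem1`), and hence
`repulsion_vacuous_upTo_1e10` / `repulsion_vacuous_upTo_1e9`: for `400 000 < q ≤ 10¹⁰` (resp.
`10⁹`) the hypothesis of Corollary 1.1 cannot be met — the printed remark "vacuous for
`q ≤ 400,000`" extended by the column REALCHAR.

## References

* [BenliGoelTwissZaman2025] K. Benli, S. Goel, H. Twiss, A. Zaman, PAMS 2025, arXiv:2410.06082,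
  Cor. 1.1, Cor. 1.2, Thm. 1.3, Hyp. 2.1, Prop. 2.4, Hyp. 2.6, Thm. 2.8, Lemma 2.9.
* [ThornerZaman2024LogFree] J. Thorner, A. Zaman, Forum Math. 36 (2024), arXiv:2208.11123
  (the constants `54.2, 16.9, 104.7, 0.0002`, as reported ibid.; Prop. 2.10 = Prop. 2.4 here).
* [LuZamanZhao2026] (`luZamanZhao2026_theorem11`), [McCurley1984ZFR] (`McCurley1984_theorem1`),
  [Platt2016GRH] — the certified ranges.
-/

noncomputable section

namespace Literature.NumberTheory.LFunctions

namespace BGTZ2025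

/-! ### The shape of (1.2) -/

/-- The right-hand side of (1.2): `1 − log( c₄ / ((1 − β₁)(c₁ log q + c₂ log T + c₃)) ) /
(c₁ log q + c₂ log T + c₃)`. [cite: BenliGoelTwissZaman2025, Corollary 1.1 (1.2)] -/
def repulsionBound (c₁ c₂ c₃ c₄ : ℝ) (q : ℕ) (T β₁ : ℝ) : ℝ :=
  1 - Real.log (c₄ / ((1 - β₁) * (c₁ * Real.log q + c₂ * Real.log T + c₃))) /
        (c₁ * Real.log q + c₂ * Real.log T + c₃)

/-- **"(1.2) holds for the modulus `q` at height `T` with constants `c₁, c₂, c₃, c₄`"**: whenever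
`𝓛_q(s) = ∏_{χ mod q} L(s,χ)` has a real zero `β₁ ∈ (1 − 1/(10 log q), 1)` (i.e. `L(β₁, χ₁) = 0`
for some `χ₁ mod q`) and `ρ ≠ β₁`, `ρ ≠ 1` is another zero of `𝓛_q(s)` (`L(ρ, χ) = 0` for some
`χ mod q`) with `Re ρ > 1/2` and `|Im ρ| ≤ T`, then `Re ρ < repulsionBound c₁ c₂ c₃ c₄ q T β₁`.
[cite: BenliGoelTwissZaman2025, Corollary 1.1 (1.2)] -/
def Repulsion (c₁ c₂ c₃ c₄ : ℝ) (q : ℕ) [NeZero q] (T : ℝ) : Prop :=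
  ∀ (χ₁ : DirichletCharacter ℂ q) (β₁ : ℝ), 1 - 1 / (10 * Real.log q) < β₁ → β₁ < 1 →
    χ₁.LFunction β₁ = 0 →
      ∀ (χ : DirichletCharacter ℂ q) (ρ : ℂ), ρ ≠ 1 → ρ ≠ (β₁ : ℂ) → χ.LFunction ρ = 0 →
        1 / 2 < ρ.re → |ρ.im| ≤ T → ρ.re < repulsionBound c₁ c₂ c₃ c₄ q T β₁

/-! ### Hypotheses 2.1 and 2.6 -/

/-- **Hypothesis 2.1 (uniform explicit subconvexity with parameters `A, θ`).** "Assume for `t ∈ ℝ`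
and any primitive Dirichlet character `ψ (mod q_ψ)` that `|L(1/2 + it, ψ)| ≤ A (q_ψ (1 + |t|))^θ`."
(All conductors `q_ψ ≥ 1`; `q_ψ = 1` is `ζ`.) A parametrised predicate.
[cite: BenliGoelTwissZaman2025, Hypothesis 2.1] -/
def HypothesisA (A θ : ℝ) : Prop :=
  ∀ (q : ℕ) [NeZero q] (ψ : DirichletCharacter ℂ q), ψ.IsPrimitive → ∀ t : ℝ,
    ‖ψ.LFunction (1 / 2 + t * Complex.I)‖ ≤ A * ((q : ℝ) * (1 + |t|)) ^ θ

/-- **Hypothesis 2.6 (explicit upper bound for the putative Landau–Siegel zero, parameters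
`B, ε`).** "For any integer `q ≥ 3`, if `𝓛_q(s)` given by (1.1) has a real zero at `s = β₁`
satisfying `β₁ > 1 − 1/(10 log q)`, then `β₁ < 1 − B/(q^ε (log q)²)`." Rendered with `β₁ < 1`
(a zero, not the pole). A parametrised predicate. [cite: BenliGoelTwissZaman2025, Hypothesis 2.6] -/
def HypothesisB (B ε : ℝ) : Prop :=
  ∀ (q : ℕ) [NeZero q], 3 ≤ q → ∀ (χ : DirichletCharacter ℂ q) (β₁ : ℝ),
    1 - 1 / (10 * Real.log q) < β₁ → β₁ < 1 → χ.LFunction β₁ = 0 →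
      β₁ < 1 - B / ((q : ℝ) ^ ε * Real.log q ^ 2)

/-! ### The named facts -/

/-- **Proposition 2.4 (Thorner–Zaman 2024, Prop. 2.10, as quoted): explicit convexity.** "For
`t ∈ ℝ` and any primitive character `ψ (mod q_ψ)`, `|L(1/2 + it, ψ)| ≤ 2.97655 (q_ψ(1 + |t|))^{1/4}`",
i.e. Hypothesis 2.1 with `A = 2.97655`, `θ = 1/4`. NAMED FACT, not proved here.
[cite: BenliGoelTwissZaman2025, Proposition 2.4] [cite: ThornerZaman2024LogFree, Proposition 2.10] -/
def proposition24_thornerZaman : Prop :=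
  HypothesisA 2.97655 (1 / 4)

/-- **Theorem 2.8 (Bordignon, as quoted and weakened in the source).** "Hypothesis 2.6 holds with
`ε = 1/2` and `B = 100`" ("[Bordignon 2019] gives `B = 800` for odd characters and [Bordignon 2020]
gives `B = 100` for even characters. The theorem is weaker than these two results.") NAMED FACT,
not proved here. [cite: BenliGoelTwissZaman2025, Theorem 2.8] -/
def theorem28_bordignon : Prop :=
  HypothesisB 100 (1 / 2)

/-- **Lemma 2.9 (the Landau–Siegel zero against `L(1, χ₁)`, explicitly).** "Let `q > 400,000` be
an integer. If `1 − 1/(10 log q) < β₁ < 1` is a real zero of `L(s, χ₁)` where `χ₁ (mod q)` is a real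
quadratic character, then `0.72 ≤ L(1,χ₁)/(1 − β₁) ≤ 0.18 (log q)²`." Rendered for quadratic
`χ₁ ≠ χ₀` (`L(1,χ₁)` is then real; stated on the real part), as the two inequalities
`0.72 (1 − β₁) ≤ L(1,χ₁) ≤ 0.18 (log q)² (1 − β₁)`. NAMED FACT, not proved here (the source proves
it in §3 from Bordignon's and Platt's inputs). ERRATUM-CLASS NOTE (cell `parity-realchar`, theory ruling
E-lemma29-upper, CONDITIONALS v1.3r, 2026-08-28): the print's §3 proves the LOWER inequality and says «the
upper bound follows from [Bordignon 2019]»; Bordignon's `L′`-bounds (J. Number Theory 201 (2019) Thm 1.2) are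
for PRIMITIVE real characters, so at the imprimitive generality rendered here the UPPER inequality `.2` is not
supported by anything in print (the Euler factor `∏_{p ∣ q, p ∤ q′}(1 − χ⋆(p)/p)` of `L(1,χ₁)` is uncontrolled)
— do not consume `.2` for imprimitive `χ₁`. Derived forms (`ExplicitExceptionalZeroBoundsRealCharacters`): the
lower half for every quadratic `χ₁` modulo Platt's table, `BGTZ2025.lemma29_lower_of_platt`; the upper half for
PRIMITIVE `χ₁` on this window with the kernel constant `½`, `BGTZ2025.lemma29_upper_primitive` (PROVED); both
halves for primitive quadratic `χ₁`, `BGTZ2025.lemma29_primitive_of_platt`. The statement below is unchanged.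
[cite: BenliGoelTwissZaman2025, Lemma 2.9] [cite: Bordignon2019, Theorem 1.2] -/
def lemma29 : Prop :=
  ∀ (q : ℕ) [NeZero q], 400000 < q → ∀ χ₁ : DirichletCharacter ℂ q, χ₁.IsQuadratic → χ₁ ≠ 1 →
    ∀ β₁ : ℝ, 1 - 1 / (10 * Real.log q) < β₁ → β₁ < 1 → χ₁.LFunction β₁ = 0 →
      0.72 * (1 - β₁) ≤ (χ₁.LFunction 1).re ∧
        (χ₁.LFunction 1).re ≤ 0.18 * Real.log q ^ 2 * (1 - β₁)

/-- **Corollary 1.1 (explicit Deuring–Heilbronn for Dirichlet `L`-functions).** "Let `T ≥ 4` be real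
and `q > 400,000` be an integer. Assume `𝓛_q(s)` has a real zero at `s = β₁ > 1 − 1/(10 log q)`. If
`ρ = β + iγ` is another zero of `𝓛_q(s)` satisfying `β > 1/2` and `|γ| ≤ T`, then
`β < 1 − log(c₄/((1 − β₁)(c₁ log q + c₂ log T + c₃)))/(c₁ log q + c₂ log T + c₃)` where
`c₁ = 10, c₂ = 1, c₃ = 107, c₄ = 1/16`." NAMED FACT, not proved here (Theorem 1.3 with
Proposition 2.4 and Theorem 2.8). Vacuous for `q ≤ 400,000` by Platt (source), for `q ≤ 10¹⁰` by
`repulsion_vacuous_upTo_1e10` below. [cite: BenliGoelTwissZaman2025, Corollary 1.1] -/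
def corollary11 : Prop :=
  ∀ (q : ℕ) [NeZero q], 400000 < q → ∀ T : ℝ, 4 ≤ T → Repulsion 10 1 107 (1 / 16) q T

/-- **Corollary 1.2 (ineffective form with better constants).** "Fix `ε > 0`. Let `T ≥ 4` be real
and `q > 400,000` be an integer. … then (1.2) holds with `c₁ = 4/3 + ε, c₂ = 2/3 + ε, c₃ = 0,
c₄ = 1/24`, provided `qT ≥ C(ε)` for some ineffective sufficiently large positive constant `C(ε)`."
NAMED FACT, not proved here (Theorem 1.3 with Petrow–Young and Siegel).
[cite: BenliGoelTwissZaman2025, Corollary 1.2] -/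
def corollary12 : Prop :=
  ∀ ε : ℝ, 0 < ε → ∃ C : ℝ, ∀ (q : ℕ) [NeZero q], 400000 < q → ∀ T : ℝ, 4 ≤ T →
    C ≤ (q : ℝ) * T → Repulsion (4 / 3 + ε) (2 / 3 + ε) 0 (1 / 24) q T

/-- The quantity `K = 10^{25} A^{20} B^{−2} e^{8(log q)^{3/4}} (log q)^{28}` of (1.5) **in arXiv v1/v2**
(ERRATUM 2026-08-27: the refereed (1.5) has a different `K`, see `theorem13K'`).
[cite: BenliGoelTwissZaman2025, Theorem 1.3 (1.5), arXiv:2410.06082v2] -/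
def theorem13K (A B : ℝ) (q : ℕ) : ℝ :=
  (10 : ℝ) ^ (25 : ℕ) * A ^ (20 : ℕ) * B ^ (-(2 : ℝ)) *
    Real.exp (8 * Real.log q ^ ((3 : ℝ) / 4)) * Real.log q ^ (28 : ℕ)

/-- The quantity `M = K q^{8θ+2ε} T^{4θ}` of (1.5). [cite: BenliGoelTwissZaman2025, Theorem 1.3 (1.5)] -/
def theorem13M (A B θ ε : ℝ) (q : ℕ) (T : ℝ) : ℝ :=
  theorem13K A B q * (q : ℝ) ^ (8 * θ + 2 * ε) * T ^ (4 * θ)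

/-- **ERRATUM (2026-08-27).** This declaration (with `theorem13K`, `theorem13M`) transcribes Theorem 1.3 of
**arXiv v1/v2** (October 2024) of the source; the ACCEPTED version — arXiv:2410.06082**v3** (January 2026)
= Proc. Amer. Math. Soc. **154** (2026), no. 2, 509–525 — prints the same theorem with a DIFFERENT constant
`K` (see `theorem13K'` / `theorem13'` below, which carry the refereed statement). Cite print as
`theorem13'`; this body is kept unchanged for its consumers and is NOT the refereed statement.

**Theorem 1.3 (arXiv v2 form, general parameters).** "Let `q > 400,000` and `T ≥ 4`.
Fix `A, B ≥ 1`, `0 < θ ≤ 1/4`, and `0 < ε ≤ 1/2`. Assume every primitive Dirichlet character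
`ψ (mod q_ψ)` satisfies `|L(1/2 + it, ψ)| ≤ A (q_ψ(1 + |t|))^θ` for `t ∈ ℝ` [Hypothesis 2.1].
Assume `𝓛_q(s)` has a real zero at `s = β₁` satisfying `1 − 1/(10 log q) < β₁ < 1 − B/(q^ε (log q)²)`.
If `ρ = β + iγ` is another zero of `𝓛_q(s)` satisfying `β > 1/2` and `|γ| ≤ T`, then
`β < 1 − log(θ/(4(1 − β₁) log M))/log M`, where `M = K q^{8θ+2ε} T^{4θ}` and
`K = 10^{25} A^{20} B^{−2} e^{8(log q)^{3/4}} (log q)^{28}`." NAMED FACT, not proved here.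
SUPERSEDED PREPRINT FORM: this is Theorem 1.3 of arXiv:2410.06082v2 with its constant `K` of (1.5); the
authors' refereed version (arXiv v3 = Proc. Amer. Math. Soc. 154 (2026) 509–525) replaces `K`, so this exact
statement is asserted by no refereed source (tagged as a claim, not a cite) — the print fact is `theorem13'`.
[claim: BenliGoelTwissZaman2025, status: disputed] -/
def theorem13 : Prop :=
  ∀ (q : ℕ) [NeZero q], 400000 < q → ∀ T : ℝ, 4 ≤ T →
    ∀ A B θ ε : ℝ, 1 ≤ A → 1 ≤ B → 0 < θ → θ ≤ 1 / 4 → 0 < ε → ε ≤ 1 / 2 → HypothesisA A θ →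
      ∀ (χ₁ : DirichletCharacter ℂ q) (β₁ : ℝ), 1 - 1 / (10 * Real.log q) < β₁ →
        β₁ < 1 - B / ((q : ℝ) ^ ε * Real.log q ^ 2) → χ₁.LFunction β₁ = 0 →
          ∀ (χ : DirichletCharacter ℂ q) (ρ : ℂ), ρ ≠ 1 → ρ ≠ (β₁ : ℂ) → χ.LFunction ρ = 0 →
            1 / 2 < ρ.re → |ρ.im| ≤ T →
              ρ.re < 1 - Real.log (θ / (4 * (1 - β₁) * Real.log (theorem13M A B θ ε q T))) /
                Real.log (theorem13M A B θ ε q T)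

/-! ### The refereed form of Theorem 1.3 (arXiv v3 = Proc. AMS 154 (2026) 509–525)

ERRATUM 2026-08-27 (cell `landau-siegel` §C r3, provenance sweep). The source has three arXiv
versions; v3 (source file dated 2026-01-09, the accepted manuscript, revisions typeset in red) changes
exactly one displayed constant among those this file records: in Theorem 1.3 (1.5),
`K = 10^{25} A^{20} B^{−2} e^{8(log q)^{3/4}} (log q)^{28}` (v1/v2) becomes
`K = (3 × 10^{16}) A^{8} B^{−2} e^{8(log q)^{3/4}} (log(14A²q³))^{24} (log q)^{4}` (v3), with all
hypotheses and the conclusion `β < 1 − log(θ/(4(1 − β₁) log M))/log M`, `M = K q^{8θ+2ε} T^{4θ}`,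
unchanged (v3 also revises the interior constants of the proof in §§3–5 — `R = 256A²q^{2θ}e^{2(log q)^{3/4}}(1−β₁)⁻²`,
`5.5 × 10⁷`, `1.6 × 10⁸`, `log(14A²q³)` for `log(2eR)` — so the new `K` is a correction of the v2
bookkeeping, not a restyling). Since `K_{v2}/K_{v3} < 1.2·10⁻³·A¹²`, the v2 form claims a smaller `M` than the refereed
theorem when `A ≲ 1.76` and a larger one when `A ≈ 3`; neither version implies the other on the whole
parameter range, so the refereed statement is vendored separately (primed names) and the v2
declarations above keep their bodies for their consumers. UNCHANGED between v2 and v3, hence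
unaffected here: Corollary 1.1 (`corollary11`: `c₁,…,c₄ = 10, 1, 107, 1/16`, whose proof the authors
re-ran with the new `K` and `A = 3`: "`8(log q)^{3/4} + 24 log log(126q³) + 4 log log q +
log((3×10^{16})·3⁸·100⁻²) ≤ 7 log q + 107` for `q > 400,000` … verified with Maple"), Corollary 1.2
(`corollary12`), Proposition 2.4 (`proposition24_thornerZaman`), Theorem 2.8 (`theorem28_bordignon`),
Lemma 2.9 (`lemma29`). -/

/-- The refereed quantity `K = (3 × 10^{16}) A^{8} B^{−2} e^{8(log q)^{3/4}} (log(14A²q³))^{24} (log q)^{4}`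
of (1.5). [cite: BenliGoelTwissZaman2025, Theorem 1.3 (1.5), arXiv:2410.06082v3 = Proc. Amer. Math.
Soc. 154 (2026) 509–525] -/
def theorem13K' (A B : ℝ) (q : ℕ) : ℝ :=
  3 * (10 : ℝ) ^ (16 : ℕ) * A ^ (8 : ℕ) * B ^ (-(2 : ℝ)) * Real.exp (8 * Real.log q ^ ((3 : ℝ) / 4)) *
    Real.log (14 * A ^ 2 * (q : ℝ) ^ (3 : ℕ)) ^ (24 : ℕ) * Real.log q ^ (4 : ℕ)

/-- The refereed `M = K q^{8θ+2ε} T^{4θ}` of (1.5), with `K = theorem13K'`.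
[cite: BenliGoelTwissZaman2025, Theorem 1.3 (1.5), arXiv v3 = PAMS 154 (2026)] -/
def theorem13M' (A B θ ε : ℝ) (q : ℕ) (T : ℝ) : ℝ :=
  theorem13K' A B q * (q : ℝ) ^ (8 * θ + 2 * ε) * T ^ (4 * θ)

/-- **Theorem 1.3 (refereed form).** "Let `q > 400,000` and `T ≥ 4`. Fix `A, B ≥ 1`, `0 < θ ≤ 1/4`,
and `0 < ε ≤ 1/2`. Assume that every primitive Dirichlet character `ψ (mod q_ψ)` satisfies
`|L(1/2 + it, ψ)| ≤ A (q_ψ(1 + |t|))^θ` for `t ∈ ℝ`. Assume `𝓛_q(s)` given by (1.1) has a real zero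
at `s = β₁` satisfying `1 − 1/(10 log q) < β₁ < 1 − B/(q^ε (log q)²)`. If `ρ = β + iγ` is another
zero of `𝓛_q(s)` satisfying `β > 1/2` and `|γ| ≤ T`, then `β < 1 − log(θ/(4(1 − β₁) log M))/log M`,
where `M = K q^{8θ+2ε} T^{4θ}` and
`K = (3 × 10^{16}) A^{8} B^{−2} e^{8(log q)^{3/4}} (log(14A²q³))^{24} (log q)^{4}`." Binders exactly as
in `theorem13` (same reading of "another zero": `ρ ≠ 1`, `ρ ≠ β₁`, any `χ, χ₁ mod q`); only `M`
differs. NAMED FACT, not proved here.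
[cite: BenliGoelTwissZaman2025, Theorem 1.3, arXiv:2410.06082v3 (2026-01) = Proc. Amer. Math. Soc.
154 (2026), no. 2, 509–525] -/
def theorem13' : Prop :=
  ∀ (q : ℕ) [NeZero q], 400000 < q → ∀ T : ℝ, 4 ≤ T →
    ∀ A B θ ε : ℝ, 1 ≤ A → 1 ≤ B → 0 < θ → θ ≤ 1 / 4 → 0 < ε → ε ≤ 1 / 2 → HypothesisA A θ →
      ∀ (χ₁ : DirichletCharacter ℂ q) (β₁ : ℝ), 1 - 1 / (10 * Real.log q) < β₁ →
        β₁ < 1 - B / ((q : ℝ) ^ ε * Real.log q ^ 2) → χ₁.LFunction β₁ = 0 →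
          ∀ (χ : DirichletCharacter ℂ q) (ρ : ℂ), ρ ≠ 1 → ρ ≠ (β₁ : ℂ) → χ.LFunction ρ = 0 →
            1 / 2 < ρ.re → |ρ.im| ≤ T →
              ρ.re < 1 - Real.log (θ / (4 * (1 - β₁) * Real.log (theorem13M' A B θ ε q T))) /
                Real.log (theorem13M' A B θ ε q T)

/-- Unfolding lemma: the refereed `M` is the refereed `K` times `q^{8θ+2ε} T^{4θ}` (display (1.5)).
[cite: BenliGoelTwissZaman2025, Theorem 1.3 (1.5), arXiv:2410.06082v3] -/
theorem theorem13M'_def (A B θ ε : ℝ) (q : ℕ) (T : ℝ) :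
    theorem13M' A B θ ε q T = theorem13K' A B q * (q : ℝ) ^ (8 * θ + 2 * ε) * T ^ (4 * θ) := rfl

/-! ### Bookkeeping (proved) -/

/-- Hypothesis 2.6 is antitone in `B`: a bound with `B` gives one with any `B' ≤ B`.
[cite: BenliGoelTwissZaman2025, Hypothesis 2.6] -/
theorem HypothesisB.anti {B B' ε : ℝ} (hBB : B' ≤ B) (h : HypothesisB B ε) : HypothesisB B' ε := by
  intro q _ hq χ β₁ hlo hhi hz
  have h1 := h q hq χ β₁ hlo hhi hz
  have hq3 : (3 : ℝ) ≤ q := by exact_mod_cast hq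
  have hden : 0 ≤ (q : ℝ) ^ ε * Real.log q ^ 2 :=
    mul_nonneg (Real.rpow_nonneg (by linarith) _) (sq_nonneg _)
  have : B' / ((q : ℝ) ^ ε * Real.log q ^ 2) ≤ B / ((q : ℝ) ^ ε * Real.log q ^ 2) :=
    div_le_div_of_nonneg_right hBB hden
  linarith

/-- Hypothesis 2.1 is monotone in `A` (for `A ≤ A'`). [cite: BenliGoelTwissZaman2025, Hypothesis 2.1] -/
theorem HypothesisA.mono {A A' θ : ℝ} (hAA : A ≤ A') (h : HypothesisA A θ) : HypothesisA A' θ := by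
  intro q _ ψ hψ t
  refine (h q ψ hψ t).trans (mul_le_mul_of_nonneg_right hAA ?_)
  exact Real.rpow_nonneg (mul_nonneg (Nat.cast_nonneg q) (by positivity)) _

/-! ### Vacuity on the certified ranges -/

/-- **No Landau–Siegel zero in the `c = 1/10` window on an exception-free table.** Under
`ZeroFreeRegionUpTo Q 10 10` (McCurley's region with `R = 10`, floor `M₀ = 10`, WITHOUT exception,
for all moduli `3 ≤ q ≤ Q`): for every modulus `10 ≤ q ≤ Q`, every Dirichlet character `χ` mod `q`
and every real `β₁` with `1 − 1/(10 log q) < β₁ < 1`, `L(β₁, χ) ≠ 0` — the common hypothesis of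
Corollaries 1.1, 1.2 and Theorem 1.3 is void at such `q`. (At `t = 0` the region reads
`σ > 1 − 1/(10 log max(q, 10)) = 1 − 1/(10 log q)`.) [cite: BenliGoelTwissZaman2025, Corollary 1.1 (Remarks)] -/
theorem no_landauSiegelZero_of_zeroFreeRegionUpTo {Q : ℕ} (hZ : ZeroFreeRegionUpTo Q 10 10)
    {q : ℕ} [NeZero q] (hq10 : 10 ≤ q) (hqQ : q ≤ Q) (χ : DirichletCharacter ℂ q) {β₁ : ℝ}
    (hlo : 1 - 1 / (10 * Real.log q) < β₁) (hhi : β₁ < 1) : χ.LFunction β₁ ≠ 0 := by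
  have hq3 : 3 ≤ q := le_trans (by norm_num) hq10
  have hne : (β₁ : ℂ) ≠ 1 := by
    intro h
    have : β₁ = 1 := by exact_mod_cast h
    linarith
  refine hZ q hq3 hqQ χ (β₁ : ℂ) hne ?_
  have hq10r : (10 : ℝ) ≤ q := by exact_mod_cast hq10
  have hmax : max (max (q : ℝ) ((q : ℝ) * |(β₁ : ℂ).im|)) 10 = q := by
    rw [Complex.ofReal_im, abs_zero, mul_zero, max_eq_left (by linarith : (0 : ℝ) ≤ q),
      max_eq_left hq10r]
  rw [hmax, Complex.ofReal_re]
  exact hlo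

/-- **Instance `Q = 10⁹` (column REALCHAR, two-lineage certified leaf + McCurley's Theorem 1).**
Under `NoRealZeroUpTo_1e9` and `McCurley1984_theorem1`: for `10 ≤ q ≤ 10⁹`, no `L(s, χ)`, `χ` mod
`q`, has a real zero in `(1 − 1/(10 log q), 1)`. (`NoRealZeroUpTo 10⁹ ⇒ NoExceptionalZeroUpTo 10⁹ (1/10)`
and `zeroFreeRegionUpTo_of_noExceptionalZeroUpTo` with `R = 10 ≥ R₀ = 9.645908801`, `10·(1/10) ≥ 1`.)
[cite: McCurley1984ZFR, Theorem 1] -/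
theorem no_landauSiegelZero_upTo_1e9 (hW : NoRealZeroUpTo_1e9) (hM : McCurley1984_theorem1)
    {q : ℕ} [NeZero q] (hq10 : 10 ≤ q) (hqQ : q ≤ 1000000000) (χ : DirichletCharacter ℂ q)
    {β₁ : ℝ} (hlo : 1 - 1 / (10 * Real.log q) < β₁) (hhi : β₁ < 1) : χ.LFunction β₁ ≠ 0 := by
  have hN : NoExceptionalZeroUpTo 1000000000 (1 / 10) :=
    NoRealZeroUpTo.noExceptionalZeroUpTo hW (1 / 10)
  have hZ : ZeroFreeRegionUpTo 1000000000 10 10 :=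
    zeroFreeRegionUpTo_of_noExceptionalZeroUpTo hM (by norm_num) hN (by norm_num) (by norm_num)
      (by norm_num)
  exact no_landauSiegelZero_of_zeroFreeRegionUpTo hZ hq10 hqQ χ hlo hhi

/-- **Instance `Q = 10¹⁰` (Lu–Zaman–Zhao's Theorem 1.1 + McCurley's Theorem 1, both named facts).**
For `10 ≤ q ≤ 10¹⁰`, no `L(s, χ)`, `χ` mod `q`, has a real zero in `(1 − 1/(10 log q), 1)` — the
tree's `luZamanZhao2026_corollary12_of` at real points. [cite: LuZamanZhao2026, Corollary 1.2] -/
theorem no_landauSiegelZero_upTo_1e10 (h11 : luZamanZhao2026_theorem11) (hM : McCurley1984_theorem1)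
    {q : ℕ} [NeZero q] (hq10 : 10 ≤ q) (hqQ : q ≤ 10 ^ 10) (χ : DirichletCharacter ℂ q)
    {β₁ : ℝ} (hlo : 1 - 1 / (10 * Real.log q) < β₁) (hhi : β₁ < 1) : χ.LFunction β₁ ≠ 0 := by
  have hq3 : 3 ≤ q := le_trans (by norm_num) hq10
  have hne : (β₁ : ℂ) ≠ 1 := by
    intro h
    have : β₁ = 1 := by exact_mod_cast h
    linarith
  refine luZamanZhao2026_corollary12_of h11 hM hq3 hqQ χ hne ?_
  have hq10r : (10 : ℝ) ≤ q := by exact_mod_cast hq10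
  have hmax : max (max (q : ℝ) ((q : ℝ) * |(β₁ : ℂ).im|)) 10 = q := by
    rw [Complex.ofReal_im, abs_zero, mul_zero, max_eq_left (by linarith : (0 : ℝ) ≤ q),
      max_eq_left hq10r]
  rw [hmax, Complex.ofReal_re]
  exact hlo.le

/-- **Corollary 1.1 is vacuous for `400 000 < q ≤ 10¹⁰`** (conditional on the named facts
`luZamanZhao2026_theorem11`, `McCurley1984_theorem1`): its hypothesis — a character `χ₁` mod `q` and
a real `β₁ ∈ (1 − 1/(10 log q), 1)` with `L(β₁, χ₁) = 0` — cannot be met; a fortiori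
`Repulsion c₁ c₂ c₃ c₄ q T` holds there for ANY constants. The source records the range
`q ≤ 400,000` (Platt). [cite: BenliGoelTwissZaman2025, Corollary 1.1 (Remarks)] [cite: LuZamanZhao2026, Corollary 1.2] -/
theorem repulsion_vacuous_upTo_1e10 (h11 : luZamanZhao2026_theorem11) (hM : McCurley1984_theorem1)
    (c₁ c₂ c₃ c₄ : ℝ) {q : ℕ} [NeZero q] (hq : 400000 < q) (hqQ : q ≤ 10 ^ 10) (T : ℝ) :
    Repulsion c₁ c₂ c₃ c₄ q T := by
  intro χ₁ β₁ hlo hhi hz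
  exact absurd hz (no_landauSiegelZero_upTo_1e10 h11 hM (le_trans (by norm_num) hq.le) hqQ χ₁ hlo hhi)

/-- The same over the cell's two-lineage range: `Repulsion c₁ c₂ c₃ c₄ q T` holds vacuously for
`400 000 < q ≤ 10⁹` under `NoRealZeroUpTo_1e9` and `McCurley1984_theorem1`.
[cite: BenliGoelTwissZaman2025, Corollary 1.1 (Remarks)] [cite: McCurley1984ZFR, Theorem 1] -/
theorem repulsion_vacuous_upTo_1e9 (hW : NoRealZeroUpTo_1e9) (hM : McCurley1984_theorem1)
    (c₁ c₂ c₃ c₄ : ℝ) {q : ℕ} [NeZero q] (hq : 400000 < q) (hqQ : q ≤ 1000000000) (T : ℝ) :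
    Repulsion c₁ c₂ c₃ c₄ q T := by
  intro χ₁ β₁ hlo hhi hz
  exact absurd hz (no_landauSiegelZero_upTo_1e9 hW hM (le_trans (by norm_num) hq.le) hqQ χ₁ hlo hhi)

/-! #### The decade `10¹⁰` re-based on the cell's leaf (appended 2026-08-26)

The same vacuity at `10¹⁰` from the value-free leaf `NoRealZeroUpTo_1e10` of
`RealCharacterLadderLeaves.lean` (SWEEP-BOARD R-8: the cell's two-lineage CERTIFIED NUMERICS for the
decade `(10⁹, 10¹⁰]`, value-free until booked) in addition to the PRINT version above
(`luZamanZhao2026_theorem11`); McCurley's Theorem 1 supplies the region for the non-real characters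
in both. -/

/-- **Instance `Q = 10¹⁰`, CERTIFIED-NUMERICS version (leaf `NoRealZeroUpTo_1e10` + McCurley's
Theorem 1):** for `10 ≤ q ≤ 10¹⁰`, no `L(s, χ)`, `χ` mod `q`, has a real zero in
`(1 − 1/(10 log q), 1)` — same conclusion as `no_landauSiegelZero_upTo_1e10`, which rests on the
print fact `luZamanZhao2026_theorem11` instead. [cite: McCurley1984ZFR, Theorem 1] -/
theorem no_landauSiegelZero_upTo_1e10_of_leaf (hW : NoRealZeroUpTo_1e10) (hM : McCurley1984_theorem1)
    {q : ℕ} [NeZero q] (hq10 : 10 ≤ q) (hqQ : q ≤ 10 ^ 10) (χ : DirichletCharacter ℂ q)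
    {β₁ : ℝ} (hlo : 1 - 1 / (10 * Real.log q) < β₁) (hhi : β₁ < 1) : χ.LFunction β₁ ≠ 0 := by
  have hN : NoExceptionalZeroUpTo 10000000000 (1 / 10) :=
    NoRealZeroUpTo.noExceptionalZeroUpTo hW (1 / 10)
  have hZ : ZeroFreeRegionUpTo 10000000000 10 10 :=
    zeroFreeRegionUpTo_of_noExceptionalZeroUpTo hM (by norm_num) hN (by norm_num) (by norm_num)
      (by norm_num)
  exact no_landauSiegelZero_of_zeroFreeRegionUpTo hZ hq10 (by norm_num at hqQ ⊢; exact hqQ) χ hlo hhi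

/-- **Corollary 1.1 is vacuous for `400 000 < q ≤ 10¹⁰`, CERTIFIED-NUMERICS version** (leaf
`NoRealZeroUpTo_1e10` + `McCurley1984_theorem1`): `Repulsion c₁ c₂ c₃ c₄ q T` holds there for any
constants, its hypothesis being unmeetable. [cite: BenliGoelTwissZaman2025, Corollary 1.1 (Remarks)]
[cite: McCurley1984ZFR, Theorem 1] -/
theorem repulsion_vacuous_upTo_1e10_of_leaf (hW : NoRealZeroUpTo_1e10) (hM : McCurley1984_theorem1)
    (c₁ c₂ c₃ c₄ : ℝ) {q : ℕ} [NeZero q] (hq : 400000 < q) (hqQ : q ≤ 10 ^ 10) (T : ℝ) :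
    Repulsion c₁ c₂ c₃ c₄ q T := by
  intro χ₁ β₁ hlo hhi hz
  exact absurd hz
    (no_landauSiegelZero_upTo_1e10_of_leaf hW hM (le_trans (by norm_num) hq.le) hqQ χ₁ hlo hhi)


/-! #### The rung `3·10¹⁰` re-based on the cell's WIDE rung leaf (appended 2026-08-26, rc-cond g5)

The same vacuity at `3·10¹⁰` from the value-free wide rung leaf `NoRealZeroUpTo_3e10`
(`RealCharacterLadderLeaves.lean`: the conjunction of the odd rung leaf of route F and the even rung
leaf of route G, `noRealZeroUpTo_3e10_iff_odd_and_even`; CERTIFIED NUMERICS, VALUE-FREE until both rungs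
book) — PRE-REGISTERED readings; nothing here asserts a leaf. -/

/-- **Instance `Q = 3·10¹⁰`, CERTIFIED-NUMERICS version (leaf `NoRealZeroUpTo_3e10` + McCurley's
Theorem 1):** for `10 ≤ q ≤ 3·10¹⁰`, no `L(s, χ)`, `χ` mod `q`, has a real zero in
`(1 − 1/(10 log q), 1)` — i.e. no Landau–Siegel zero in the source's sense below `3·10¹⁰`.
[cite: McCurley1984ZFR, Theorem 1] [cite: BenliGoelTwissZaman2025, Corollary 1.1 (Remarks)] -/
theorem no_landauSiegelZero_upTo_3e10_of_leaf (hW : NoRealZeroUpTo_3e10) (hM : McCurley1984_theorem1)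
    {q : ℕ} [NeZero q] (hq10 : 10 ≤ q) (hqQ : q ≤ 3 * 10 ^ 10) (χ : DirichletCharacter ℂ q)
    {β₁ : ℝ} (hlo : 1 - 1 / (10 * Real.log q) < β₁) (hhi : β₁ < 1) : χ.LFunction β₁ ≠ 0 := by
  have hN : NoExceptionalZeroUpTo 30000000000 (1 / 10) :=
    NoRealZeroUpTo.noExceptionalZeroUpTo hW (1 / 10)
  have hZ : ZeroFreeRegionUpTo 30000000000 10 10 :=
    zeroFreeRegionUpTo_of_noExceptionalZeroUpTo hM (by norm_num) hN (by norm_num) (by norm_num)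
      (by norm_num)
  exact no_landauSiegelZero_of_zeroFreeRegionUpTo hZ hq10 (by norm_num at hqQ ⊢; exact hqQ) χ hlo hhi

/-- **Corollary 1.1 is vacuous for `400 000 < q ≤ 3·10¹⁰`, CERTIFIED-NUMERICS version** (leaf
`NoRealZeroUpTo_3e10` + `McCurley1984_theorem1`): `Repulsion c₁ c₂ c₃ c₄ q T` holds there for any
constants, its hypothesis being unmeetable. [cite: BenliGoelTwissZaman2025, Corollary 1.1 (Remarks)]
[cite: McCurley1984ZFR, Theorem 1] -/
theorem repulsion_vacuous_upTo_3e10_of_leaf (hW : NoRealZeroUpTo_3e10) (hM : McCurley1984_theorem1)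
    (c₁ c₂ c₃ c₄ : ℝ) {q : ℕ} [NeZero q] (hq : 400000 < q) (hqQ : q ≤ 3 * 10 ^ 10) (T : ℝ) :
    Repulsion c₁ c₂ c₃ c₄ q T := by
  intro χ₁ β₁ hlo hhi hz
  exact absurd hz
    (no_landauSiegelZero_upTo_3e10_of_leaf hW hM (le_trans (by norm_num) hq.le) hqQ χ₁ hlo hhi)

end BGTZ2025

end Literature.NumberTheory.LFunctions

end
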